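import Literature.NumberTheory.EllipticCurves.Rank1Residual.Predicates
import Literature.NumberTheory.EllipticCurves.TateModuleGaloisTransportProofs
import Literature.NumberTheory.EllipticCurves.GaloisActionProofs
import Literature.NumberTheory.EllipticCurves.VariableChangePointsMap
import Literature.NumberTheory.EllipticCurves.QuadraticBaseChangeGaloisProofs
import Literature.NumberTheory.GaloisRepresentations.AbsGaloisGroup
import Literature.NumberTheory.GaloisRepresentations.IntegralGaloisAction
import HarnessLib

/-!
# The Greenberg–Vatsal parity type under an imaginary quadratic twist (class X1 bookkeeping)

HONEST FRAMING (cell `b2b-bsdres`): the goal is to DELETE the COMBINATION-SHAPED residual classes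
of the rank-`≤ 1` BSD formula over `ℚ` from PUBLISHED theorems only and to TYPE the rest; this is
not "finishing BSD". This file proves, sorry-free, the Galois-module bookkeeping used (silently) in
Castella–Grossi–Lee–Skinner, Invent. Math. 227 (2022), proof of Thm. 5.3.1 ("by our hypotheses on
`φ` the curve `E^K` satisfies the hypotheses of Theorem 5.1.4 [Greenberg–Vatsal]") and in the X1
audit `b2b-bsdres-x1a/X1-CHAIN.md` (twist law): twisting by a quadratic character that is ODD and
UNRAMIFIED at `p` swaps the two Greenberg–Vatsal parity types of a rational `p`-isogeny kernel.

* `exists_isRationalLine_of_not_irr`: `E[p]` reducible ⇒ a rational line `Φ ≤ E[p]` (`#E[p] = p²`).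
* `lineEven_or_lineOdd`: a rational line is even or odd (complex conjugations are involutions, all
  conjugate in `Γ_ℚ`, and act on a line of prime order by `±1`).
* `gvPar_of_not_gvPar_of_twist`: if `E[p]` is reducible, `¬ GVPar W p` (no kernel of type
  (ramified ∧ even) ∨ (unramified ∧ odd)), `p ≠ 2`, and `d ∈ ℤ` with `d < 0`, `p ∤ d`, then every
  model `Wd` with `C • Wd = W.quadraticTwist d` satisfies `GVPar Wd p`: along the twist isomorphism
  `E^{(d)}(ℚ̄) ≃ E(ℚ̄)` (equivariant for `σ` fixing `√d`, anti-equivariant otherwise; Silverman AEC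
  X.5 Cor. 5.4, tree `exists_addEquiv_geomPoints_quadraticTwist_sign`) the line `Φ` goes to a
  rational line `Φ'` of `E^{(d)}[p]`; complex conjugation negates `√d` (`d < 0`), so parity flips;
  inertia at `p` fixes `√d` (`p ∤ 4d`), so (un)ramifiedness at `p` is preserved.

References: R. Greenberg, V. Vatsal, Invent. Math. 142 (2000), Thm. 1.3 (the parity condition);
F. Castella, G. Grossi, J. Lee, C. Skinner, Invent. Math. 227 (2022), proof of Thm. 5.3.1;
J. Silverman, AEC, X.5 Cor. 5.4.
-/

set_option autoImplicit false

noncomputable section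

open scoped Classical

open WeierstrassCurve Literature.NumberTheory.EllipticCurves Literature.NumberTheory.GaloisRepresentations
  Field IsDedekindDomain NumberField

namespace Literature.NumberTheory.EllipticCurves.Rank1Residual

universe u

variable (W : WeierstrassCurve ℚ) [W.IsElliptic] (p : ℕ) [Fact p.Prime]

/-! ### Rational lines from reducibility -/

/-- `#E[p] = p²` over `ℚ̄` (Silverman AEC III.6.4(b); tree `card_torsionPoints_eq_sq_holds`).
[cite: SilvermanAEC2009, Cor. III.6.4(b)] -/
theorem natCard_geomTorsion : Nat.card (geomTorsion W (p : ℤ)) = p ^ 2 :=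
  card_torsionPoints_eq_sq_holds W (AlgebraicClosure ℚ) (n := p)
    (by exact_mod_cast (Fact.out : p.Prime).ne_zero)

/-- **`E[p]` reducible ⇒ a rational line.** A `Γ_ℚ`-stable subgroup `H ≤ E[p]` with `H ≠ ⊥, ⊤`
has order `p`, because `#E[p] = p²`. [folklore] -/
theorem exists_isRationalLine_of_not_irr (hred : ¬ W.HasIrreducibleModPGaloisRep p) :
    ∃ Φ : AddSubgroup (geomTorsion W (p : ℤ)), IsRationalLine W p Φ := by
  have hp : p.Prime := Fact.out
  unfold WeierstrassCurve.HasIrreducibleModPGaloisRep at hred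
  simp only [not_forall, not_or] at hred
  obtain ⟨H, hstab, hbot, htop⟩ := hred
  have hcard := natCard_geomTorsion W p
  haveI : Finite (geomTorsion W (p : ℤ)) :=
    Nat.finite_of_card_ne_zero (by rw [hcard]; exact pow_ne_zero 2 hp.ne_zero)
  refine ⟨H, ?_, hstab⟩
  have hdvd : Nat.card H ∣ p ^ 2 := hcard ▸ H.card_addSubgroup_dvd_card
  obtain ⟨i, hi, hHi⟩ := (Nat.dvd_prime_pow hp).mp hdvd
  interval_cases i
  · exact absurd (AddSubgroup.card_eq_one.mp (by simpa using hHi)) hbot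
  · simpa using hHi
  · exact absurd ((AddSubgroup.card_eq_iff_eq_top H).mp (by rw [hHi, hcard])) htop

/-! ### A rational line is even or odd -/

variable {W p}

omit [W.IsElliptic] in
/-- An element of `Γ_ℚ` with `c² = 1` acts on a rational line `Φ ≤ E[p]` by `+1` or by `−1`
(uniformly): `Φ` is cyclic of prime order, `c` acts by a scalar `k` with `k² ≡ 1 (mod p)`.
[folklore] -/
theorem smul_eq_self_or_eq_neg_of_sq_eq_one {Φ : AddSubgroup (geomTorsion W (p : ℤ))}
    (hΦ : IsRationalLine W p Φ) {c : absoluteGaloisGroup ℚ} (hc : c ^ 2 = 1) :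
    (∀ P ∈ Φ, c • P = P) ∨ (∀ P ∈ Φ, c • P = -P) := by
  have hp : p.Prime := Fact.out
  -- `Φ` is cyclic of order `p`, generated by `g`
  haveI : Fact (Nat.card Φ).Prime := ⟨by rw [hΦ.1]; exact hp⟩
  haveI : Finite Φ := Nat.finite_of_card_ne_zero (by rw [hΦ.1]; exact hp.ne_zero)
  haveI : IsAddCyclic Φ := isAddCyclic_of_prime_card hΦ.1
  obtain ⟨g, hg⟩ := IsAddCyclic.exists_zsmul_surjective (G := Φ)
  -- `c • g = k • g`
  have hcg : c • (g : geomTorsion W (p : ℤ)) ∈ Φ := hΦ.2 c g g.2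
  obtain ⟨k, hk⟩ := hg ⟨c • (g : geomTorsion W (p : ℤ)), hcg⟩
  have hk' : c • (g : geomTorsion W (p : ℤ)) = k • (g : geomTorsion W (p : ℤ)) := by
    have := congrArg Subtype.val hk
    simpa using this.symm
  -- every `P ∈ Φ` is `m • g`, and `c • P = k • P`
  have hscalar : ∀ P ∈ Φ, c • P = k • P := by
    intro P hP
    obtain ⟨m, hm⟩ := hg ⟨P, hP⟩
    have hPm : P = m • (g : geomTorsion W (p : ℤ)) := by
      have := congrArg Subtype.val hm
      simpa using this.symm
    rw [hPm, smul_comm c m, hk', smul_comm m k]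
  -- `k² ≡ 1`: `P = c • c • P = k² • P`
  have hsq : ∀ P ∈ Φ, (k * k - 1) • P = 0 := by
    intro P hP
    have h1 : c • (c • P) = P := by rw [← mul_smul, ← pow_two, hc, one_smul]
    rw [hscalar P hP, smul_comm, hscalar P hP, smul_smul] at h1
    rw [sub_smul, one_smul, h1, sub_self]
  -- the order of every `P ∈ Φ` divides `p`
  have hpP : ∀ P ∈ Φ, (p : ℤ) • P = 0 := by
    intro P hP
    have h : Nat.card Φ • (⟨P, hP⟩ : Φ) = 0 := card_nsmul_eq_zero'
    rw [hΦ.1] at h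
    have h' := congrArg Subtype.val h
    rw [← natCast_zsmul, AddSubgroupClass.coe_zsmul] at h'
    exact h'
  -- a nonzero `P₀ ∈ Φ` (order `p > 1`)
  obtain ⟨⟨P₀, hP₀⟩, hP₀ne⟩ : ∃ x : Φ, x ≠ 0 := by
    by_contra h
    simp only [not_exists, not_not] at h
    haveI : Subsingleton Φ := ⟨fun a b ↦ by rw [h a, h b]⟩
    have h1 : Nat.card Φ = 1 := Nat.card_of_subsingleton (0 : Φ)
    rw [hΦ.1] at h1
    exact hp.one_lt.ne' h1
  have hP₀ne' : (P₀ : geomTorsion W (p : ℤ)) ≠ 0 := fun h ↦ hP₀ne (Subtype.ext h)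
  -- `p ∣ k² - 1`: the additive order of `P₀` is `p` and kills `k² - 1`
  have horder : addOrderOf P₀ = p := by
    have hdvd : addOrderOf P₀ ∣ p := by
      apply addOrderOf_dvd_of_nsmul_eq_zero
      have h0 := hpP P₀ hP₀
      rwa [natCast_zsmul] at h0
    rcases (Nat.dvd_prime hp).mp hdvd with h1 | h2
    · exact absurd (AddMonoid.addOrderOf_eq_one_iff.mp h1) hP₀ne'
    · exact h2
  have hdvd : (p : ℤ) ∣ k * k - 1 := by
    have h := hsq P₀ hP₀
    have h' := (addOrderOf_dvd_iff_zsmul_eq_zero).mpr h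
    rw [horder] at h'
    exact h'
  have hprime : Prime (p : ℤ) := Nat.prime_iff_prime_int.mp hp
  have hfac : k * k - 1 = (k - 1) * (k + 1) := by ring
  rw [hfac] at hdvd
  rcases hprime.dvd_or_dvd hdvd with h1 | h1
  · left
    intro P hP
    obtain ⟨t, ht⟩ := h1
    rw [hscalar P hP]
    have : k = 1 + (p : ℤ) * t := by linarith
    rw [this, add_smul, one_smul, mul_comm, mul_smul, hpP P hP, smul_zero, add_zero]
  · right
    intro P hP
    obtain ⟨t, ht⟩ := h1
    rw [hscalar P hP]
    have : k = -1 + (p : ℤ) * t := by linarith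
    rw [this, add_smul, neg_one_smul, mul_comm, mul_smul, hpP P hP, smul_zero, add_zero]

omit [W.IsElliptic] in
/-- **A rational line is even or odd.** Complex conjugations of `Γ_ℚ` are involutions
(`IsComplexConjugation.sq_eq_one`) and pairwise conjugate (`IsComplexConjugation.isConj`); one of
them acts on the line by `ε = ±1` (`smul_eq_self_or_eq_neg_of_sq_eq_one`), and then so does every
conjugate `ν c ν⁻¹`, the line being `Γ_ℚ`-stable. [folklore] -/
theorem lineEven_or_lineOdd {Φ : AddSubgroup (geomTorsion W (p : ℤ))} (hΦ : IsRationalLine W p Φ) :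
    LineEven W p Φ ∨ LineOdd W p Φ := by
  obtain ⟨c₀, hc₀⟩ := exists_isComplexConjugation (Rat.castHom ℝ)
  -- transport along conjugation: `c = ν c₀ ν⁻¹`
  have key : ∀ (ε : geomTorsion W (p : ℤ) → geomTorsion W (p : ℤ)),
      (∀ (ν : absoluteGaloisGroup ℚ) P, ν • ε P = ε (ν • P)) →
      (∀ P ∈ Φ, c₀ • P = ε P) →
      ∀ c : absoluteGaloisGroup ℚ, IsComplexConjugation (Rat.castHom ℝ) c → ∀ P ∈ Φ, c • P = ε P := by
    intro ε hε h0 c hc P hP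
    obtain ⟨ν, hν⟩ := isConj_iff.mp (hc₀.isConj hc)
    rw [← hν]
    have hmem : ν⁻¹ • P ∈ Φ := hΦ.2 ν⁻¹ P hP
    calc (ν * c₀ * ν⁻¹) • P = ν • (c₀ • (ν⁻¹ • P)) := by rw [mul_smul, mul_smul]
      _ = ν • ε (ν⁻¹ • P) := by rw [h0 _ hmem]
      _ = ε (ν • (ν⁻¹ • P)) := hε ν _
      _ = ε P := by rw [smul_inv_smul]
  rcases smul_eq_self_or_eq_neg_of_sq_eq_one hΦ hc₀.sq_eq_one with h | h
  · left
    exact key id (fun _ _ ↦ rfl) h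
  · right
    exact key (fun P ↦ -P) (fun ν P ↦ smul_neg ν P) h

/-! ### The quadratic character at complex conjugation and at inertia above `p` -/

/-- **Complex conjugation negates `√d` for `d < 0`.** Under any embedding `ι : ℚ̄ → ℂ` realising `c`
as complex conjugation, `ι(√d)` is fixed by conjugation iff real, and a real number has nonnegative
square, whereas `ι(√d)² = d < 0`. [folklore] -/
theorem smul_geomSqrt_eq_neg_of_isComplexConjugation {d : ℚ} (hd : d < 0)
    {c : absoluteGaloisGroup ℚ} (hc : IsComplexConjugation (Rat.castHom ℝ) c) :
    c • geomSqrt d = -geomSqrt d := by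
  rcases smul_geomSqrt_eq_or c d with h | h
  swap
  · exact h
  exfalso
  obtain ⟨ι, hι, hιc⟩ := isComplexConjugation_iff.mp hc
  set z : ℂ := ι (geomSqrt d) with hz
  have hreal : starRingEnd ℂ z = z := by rw [hz, ← hιc, h]
  have hsq : z ^ 2 = ((d : ℝ) : ℂ) := by
    rw [hz, ← map_pow, geomSqrt_sq]
    have h' := RingHom.congr_fun hι d
    simp only [RingHom.coe_comp, Function.comp_apply] at h'
    rw [h']
    simp
  have him : z.im = 0 := Complex.conj_eq_iff_im.mp hreal
  have hre : (z ^ 2).re = z.re * z.re - z.im * z.im := by rw [pow_two, Complex.mul_re]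
  rw [hsq, him, mul_zero, sub_zero, Complex.ofReal_re] at hre
  have h0 : (0 : ℝ) ≤ (d : ℝ) := by rw [hre]; exact mul_self_nonneg _
  have h1 : (d : ℝ) < 0 := by exact_mod_cast hd
  exact absurd h0 (not_le.mpr h1)

/-- **Inertia above `p` fixes `√d` when `p ∤ 4d`** (`ℚ(√d)/ℚ` is unramified outside `4d`;
Neukirch, *Algebraic Number Theory*, I §8; same argument as the tree's
`nodalCubic.smul_sqrt_eq_of_mem_inertia`): `√d` is integral, `σ√d − √d ∈ 𝔓`; if `σ√d = −√d` then
`2√d ∈ 𝔓`, `4d ∈ 𝔓 ∩ ℤ = v ∋ p`, and `gcd(p, 4d) = 1` puts `1 ∈ v`. [folklore] -/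
theorem smul_geomSqrt_eq_of_mem_inertia {d : ℤ} (hpd : ¬ (p : ℤ) ∣ 4 * d)
    {v : HeightOneSpectrum (𝓞 ℚ)} (hpv : (p : 𝓞 ℚ) ∈ v.asIdeal)
    {𝔓 : Ideal (absIntegers (𝓞 ℚ) ℚ)} (h𝔓 : 𝔓 ∈ v.primesAbove)
    {σ : absoluteGaloisGroup ℚ} (hσ : σ ∈ 𝔓.inertia (absoluteGaloisGroup ℚ)) :
    σ • geomSqrt ((d : ℤ) : ℚ) = geomSqrt ((d : ℤ) : ℚ) := by
  have hp : p.Prime := Fact.out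
  haveI : 𝔓.IsPrime := h𝔓.1
  have hsq : geomSqrt ((d : ℤ) : ℚ) ^ 2 = algebraMap (𝓞 ℚ) (AlgebraicClosure ℚ) (d : 𝓞 ℚ) := by
    rw [geomSqrt_sq, IsScalarTower.algebraMap_apply (𝓞 ℚ) ℚ (AlgebraicClosure ℚ)]
    simp only [map_intCast]
  have hint : _root_.IsIntegral (𝓞 ℚ) (geomSqrt ((d : ℤ) : ℚ)) :=
    IsIntegral.of_pow two_pos (by rw [hsq]; exact isIntegral_algebraMap)
  set x : absIntegers (𝓞 ℚ) ℚ := ⟨geomSqrt ((d : ℤ) : ℚ), hint⟩ with hx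
  rcases smul_geomSqrt_eq_or σ ((d : ℤ) : ℚ) with h | h
  · exact h
  · exfalso
    have hmem : σ • x - x ∈ 𝔓 := hσ x
    have h2 : (σ • x - x : absIntegers (𝓞 ℚ) ℚ) = -(2 * x) := Subtype.ext (by
      rw [AddSubgroupClass.coe_sub, integralClosure.coe_smul]
      change σ • geomSqrt ((d : ℤ) : ℚ) - geomSqrt ((d : ℤ) : ℚ) = _
      rw [h]
      change _ = -(2 * geomSqrt ((d : ℤ) : ℚ))
      ring)
    rw [h2, neg_mem_iff] at hmem
    have h4 : (2 * x) * (2 * x) = algebraMap (𝓞 ℚ) (absIntegers (𝓞 ℚ) ℚ) (4 * (d : 𝓞 ℚ)) :=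
      Subtype.ext (by
        rw [map_mul]
        change (2 * geomSqrt ((d : ℤ) : ℚ)) * (2 * geomSqrt ((d : ℤ) : ℚ)) = _
        rw [show (2 * geomSqrt ((d : ℤ) : ℚ)) * (2 * geomSqrt ((d : ℤ) : ℚ)) =
          4 * geomSqrt ((d : ℤ) : ℚ) ^ 2 by ring, hsq]
        change _ = ((algebraMap (𝓞 ℚ) (absIntegers (𝓞 ℚ) ℚ) 4 : absIntegers (𝓞 ℚ) ℚ) :
          AlgebraicClosure ℚ) * (algebraMap (𝓞 ℚ) (absIntegers (𝓞 ℚ) ℚ) (d : 𝓞 ℚ) : AlgebraicClosure ℚ)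
        rw [map_ofNat]
        rfl)
    have hmem4 : algebraMap (𝓞 ℚ) (absIntegers (𝓞 ℚ) ℚ) (4 * (d : 𝓞 ℚ)) ∈ 𝔓 := by
      rw [← h4]; exact 𝔓.mul_mem_left _ hmem
    have hv4 : (4 * (d : 𝓞 ℚ) : 𝓞 ℚ) ∈ v.asIdeal := by
      rw [h𝔓.2.over, Ideal.under_def, Ideal.mem_comap]
      exact hmem4
    -- `gcd(p, 4d) = 1` gives `1 ∈ v`
    have hcop : IsCoprime (p : ℤ) (4 * d) :=
      (Prime.coprime_iff_not_dvd (Nat.prime_iff_prime_int.mp hp)).mpr hpd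
    obtain ⟨a, b, hab⟩ := hcop
    have h1 : (1 : 𝓞 ℚ) ∈ v.asIdeal := by
      have hcast : ((a * p + b * (4 * d) : ℤ) : 𝓞 ℚ) = 1 := by rw [hab]; norm_num
      have heq : ((a * p + b * (4 * d) : ℤ) : 𝓞 ℚ) = (a : 𝓞 ℚ) * (p : 𝓞 ℚ) + (b : 𝓞 ℚ) * (4 * (d : 𝓞 ℚ)) := by
        push_cast; ring
      rw [← hcast, heq]
      exact v.asIdeal.add_mem (v.asIdeal.mul_mem_left _ hpv) (v.asIdeal.mul_mem_left _ hv4)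
    exact v.isPrime.ne_top ((Ideal.eq_top_iff_one _).mpr h1)

/-! ### Transport of the parity type along an imaginary quadratic twist -/

/-- **Twisting by an odd character unramified at `p` swaps the Greenberg–Vatsal parity types.**
Let `W/ℚ` be elliptic, `p` an odd prime with `E[p]` reducible and `¬ GVPar W p` (no rational
`p`-isogeny kernel of type (ramified at `p` ∧ even) ∨ (unramified at `p` ∧ odd)), and `d < 0` an
integer with `p ∤ d`. Then every Weierstrass model `Wd` of the quadratic twist `E^{(d)}`
(`C • Wd = W.quadraticTwist d`) satisfies `GVPar Wd p`. Proof: a rational line `Φ ≤ E[p]`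
(`exists_isRationalLine_of_not_irr`) is even or odd (`lineEven_or_lineOdd`) and ramified or not,
hence, `GVPar W p` failing, of type (unramified ∧ even) or (ramified ∧ odd); along
`F : E^{(d)}(ℚ̄) ≃ E(ℚ̄)` — `σ`-equivariant when `σ√d = √d`, anti-equivariant when `σ√d = −√d`
(Silverman AEC X.5 Cor. 5.4; tree `exists_addEquiv_geomPoints_quadraticTwist_sign`, composed with
the change of model `Wd ≅ C • Wd`) — `Φ` pulls back to a rational line `Φ'` of `E^{(d)}[p]`;
complex conjugations negate `√d` (`smul_geomSqrt_eq_neg_of_isComplexConjugation`, `d < 0`) so the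
parity of `Φ'` is opposite to that of `Φ`, and inertia groups above `p` fix `√d`
(`smul_geomSqrt_eq_of_mem_inertia`, `p ∤ 4d`) so `Φ'` is unramified at `p` iff `Φ` is. This is
the bookkeeping behind "by our hypotheses on `φ` the curve `E^K` satisfies the hypotheses of
[Greenberg–Vatsal]" (Castella–Grossi–Lee–Skinner 2022, proof of Thm. 5.3.1).
[cite: CastellaEtAl2021, proof of Thm. 5.3.1 (last paragraph)] [cite: SilvermanAEC2009, X.5 Cor. 5.4] -/
theorem gvPar_of_not_gvPar_of_twist (hp2 : p ≠ 2) (hred : ¬ W.HasIrreducibleModPGaloisRep p)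
    (hnot : ¬ GVPar W p) {d : ℤ} (hd : d < 0) (hpd : ¬ (p : ℤ) ∣ d)
    (Wd : WeierstrassCurve ℚ) (C : VariableChange ℚ) (hC : C • Wd = W.quadraticTwist ((d : ℤ) : ℚ)) :
    GVPar Wd p := by
  have hp : p.Prime := Fact.out
  have hd0 : ((d : ℤ) : ℚ) ≠ 0 := by exact_mod_cast hd.ne
  have hdneg : ((d : ℤ) : ℚ) < 0 := by exact_mod_cast hd
  have hp4d : ¬ (p : ℤ) ∣ 4 * d := by
    intro h
    rcases (Nat.prime_iff_prime_int.mp hp).dvd_or_dvd h with h4 | h4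
    · have : (p : ℤ) ∣ 2 * 2 := by simpa [show (4 : ℤ) = 2 * 2 by norm_num] using h4
      rcases (Nat.prime_iff_prime_int.mp hp).dvd_or_dvd this with h2 | h2 <;>
      · have := Int.le_of_dvd two_pos h2
        have h1 := hp.two_le
        have : (p : ℤ) = 2 := by omega
        exact hp2 (by exact_mod_cast this)
    · exact hpd h4
  -- the twist isomorphism `F : Wd(ℚ̄) ≃+ W(ℚ̄)`, equivariant up to the sign `σ ↦ σ√d/√d`
  obtain ⟨f, hfpos, hfneg⟩ := W.exists_addEquiv_geomPoints_quadraticTwist_sign hd0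
  let e₁ : Wd.geomPoints ≃+ (C • Wd).geomPoints :=
    VariableChange.pointEquivBaseChange Wd C (AlgebraicClosure ℚ)
  let e₂ : (C • Wd).geomPoints ≃+ (W.quadraticTwist ((d : ℤ) : ℚ)).geomPoints :=
    Affine.Point.congrEquiv (congrArg (fun Z : WeierstrassCurve ℚ ↦ Z.baseChange (AlgebraicClosure ℚ)) hC)
  have h₁ : ∀ (σ : absoluteGaloisGroup ℚ) (P : Wd.geomPoints), e₁ (σ • P) = σ • e₁ P := fun σ P ↦
    VariableChange.pointEquivBaseChange_map_algEquiv Wd C (absoluteGaloisGroup.toAlgEquiv ℚ σ) P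
  have h₂ : ∀ (σ : absoluteGaloisGroup ℚ) (P : (C • Wd).geomPoints), e₂ (σ • P) = σ • e₂ P :=
    fun σ P ↦ congrEquiv_smul_of_eq hC (absoluteGaloisGroup.toAlgEquiv ℚ σ) P
  set F : Wd.geomPoints ≃+ W.geomPoints := (e₁.trans e₂).trans f with hF
  have hFpos : ∀ σ : absoluteGaloisGroup ℚ, σ • geomSqrt ((d : ℤ) : ℚ) = geomSqrt ((d : ℤ) : ℚ) →
      ∀ P, F (σ • P) = σ • F P := by
    intro σ hσ P
    simp only [hF, AddEquiv.trans_apply]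
    rw [h₁, h₂, hfpos σ hσ]
  have hFneg : ∀ σ : absoluteGaloisGroup ℚ, σ • geomSqrt ((d : ℤ) : ℚ) = -geomSqrt ((d : ℤ) : ℚ) →
      ∀ P, F (σ • P) = -(σ • F P) := by
    intro σ hσ P
    simp only [hF, AddEquiv.trans_apply]
    rw [h₁, h₂, hfneg σ hσ]
  -- `F` on `p`-torsion: a bijection `φ : Wd[p] → W[p]`
  have hmem : ∀ T : geomTorsion Wd (p : ℤ), F T ∈ geomTorsion W (p : ℤ) := by
    intro T
    rw [AddSubgroup.torsionBy.nsmul_iff, ← map_nsmul, AddSubgroup.torsionBy.nsmul_iff.mp T.2,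
      map_zero]
  let φ : geomTorsion Wd (p : ℤ) →+ geomTorsion W (p : ℤ) :=
    AddMonoidHom.codRestrict ((F : Wd.geomPoints →+ W.geomPoints).comp
      (geomTorsion Wd (p : ℤ)).subtype) (geomTorsion W (p : ℤ)) hmem
  have hφ : ∀ T, ((φ T : geomTorsion W (p : ℤ)) : W.geomPoints) = F T := fun T ↦ rfl
  have hφinj : Function.Injective φ := by
    intro T₁ T₂ h
    have h' := congrArg (fun S : geomTorsion W (p : ℤ) ↦ (S : W.geomPoints)) h
    simp only [hφ] at h'
    exact Subtype.ext (F.injective h')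
  have hφsurj : Function.Surjective φ := by
    intro S
    have hS : F.symm S ∈ geomTorsion Wd (p : ℤ) := by
      rw [AddSubgroup.torsionBy.nsmul_iff]
      apply F.injective
      rw [map_nsmul, AddEquiv.apply_symm_apply, map_zero]
      exact AddSubgroup.torsionBy.nsmul_iff.mp S.2
    refine ⟨⟨F.symm S, hS⟩, Subtype.ext ?_⟩
    rw [hφ]
    exact F.apply_symm_apply S
  let eφ : geomTorsion Wd (p : ℤ) ≃+ geomTorsion W (p : ℤ) := AddEquiv.ofBijective φ ⟨hφinj, hφsurj⟩
  have heφ : ∀ T, eφ T = φ T := fun T ↦ rfl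
  -- `φ` is equivariant up to the sign
  have hφpos : ∀ σ : absoluteGaloisGroup ℚ, σ • geomSqrt ((d : ℤ) : ℚ) = geomSqrt ((d : ℤ) : ℚ) →
      ∀ T, φ (σ • T) = σ • φ T := fun σ hσ T ↦
    Subtype.ext (by rw [AddSubgroup.torsionBy.coe_smul, hφ, hφ, AddSubgroup.torsionBy.coe_smul,
      hFpos σ hσ])
  have hφneg : ∀ σ : absoluteGaloisGroup ℚ, σ • geomSqrt ((d : ℤ) : ℚ) = -geomSqrt ((d : ℤ) : ℚ) →
      ∀ T, φ (σ • T) = -(σ • φ T) := fun σ hσ T ↦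
    Subtype.ext (by rw [AddSubgroup.coe_neg, AddSubgroup.torsionBy.coe_smul, hφ, hφ,
      AddSubgroup.torsionBy.coe_smul, hFneg σ hσ])
  -- the line `Φ ≤ E[p]` and its transport `Φ' = φ⁻¹ Φ ≤ E^{(d)}[p]`
  obtain ⟨Φ, hΦ⟩ := exists_isRationalLine_of_not_irr W p hred
  let Φ' : AddSubgroup (geomTorsion Wd (p : ℤ)) := Φ.map eφ.symm.toAddMonoidHom
  have hmemΦ' : ∀ T, T ∈ Φ' ↔ φ T ∈ Φ := by
    intro T
    rw [AddSubgroup.mem_map_equiv, AddEquiv.symm_symm, heφ]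
  have hcardΦ' : Nat.card Φ' = p :=
    (Nat.card_congr (Φ.equivMapOfInjective eφ.symm.toAddMonoidHom eφ.symm.injective).toEquiv).symm.trans
      hΦ.1
  have hstabΦ' : ∀ (σ : absoluteGaloisGroup ℚ), ∀ T ∈ Φ', σ • T ∈ Φ' := by
    intro σ T hT
    rw [hmemΦ'] at hT ⊢
    rcases smul_geomSqrt_eq_or σ ((d : ℤ) : ℚ) with hσ | hσ
    · rw [hφpos σ hσ]; exact hΦ.2 σ _ hT
    · rw [hφneg σ hσ]; exact neg_mem (hΦ.2 σ _ hT)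
  have hΦ' : IsRationalLine Wd p Φ' := ⟨hcardΦ', hstabΦ'⟩
  -- parity flips
  have hodd_of_even : LineEven W p Φ → LineOdd Wd p Φ' := by
    intro h c hc T hT
    have hcT := hφneg c (smul_geomSqrt_eq_neg_of_isComplexConjugation hdneg hc) T
    rw [h c hc (φ T) ((hmemΦ' T).mp hT), ← map_neg] at hcT
    exact hφinj hcT
  have heven_of_odd : LineOdd W p Φ → LineEven Wd p Φ' := by
    intro h c hc T hT
    have hcT := hφneg c (smul_geomSqrt_eq_neg_of_isComplexConjugation hdneg hc) T
    rw [h c hc (φ T) ((hmemΦ' T).mp hT), neg_neg] at hcT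
    exact hφinj hcT
  -- (un)ramifiedness at `p` is preserved
  have hunr_of_unr : LineUnramifiedAt W p Φ → LineUnramifiedAt Wd p Φ' := by
    intro h v hpv 𝔓 h𝔓 σ hσ T hT
    have hσd := smul_geomSqrt_eq_of_mem_inertia (p := p) hp4d hpv h𝔓 hσ
    have hσT := hφpos σ hσd T
    rw [h v hpv 𝔓 h𝔓 σ hσ (φ T) ((hmemΦ' T).mp hT)] at hσT
    exact hφinj hσT
  have hram_of_ram : ¬ LineUnramifiedAt W p Φ → ¬ LineUnramifiedAt Wd p Φ' := by
    intro h h'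
    apply h
    intro v hpv 𝔓 h𝔓 σ hσ S hS
    obtain ⟨T, rfl⟩ := hφsurj S
    have hT : T ∈ Φ' := (hmemΦ' T).mpr hS
    have hσd := smul_geomSqrt_eq_of_mem_inertia (p := p) hp4d hpv h𝔓 hσ
    rw [← hφpos σ hσd T, h' v hpv 𝔓 h𝔓 σ hσ T hT]
  -- the type of `Φ`: (unramified ∧ even) or (ramified ∧ odd), as `GVPar W p` fails
  have hnot' : ¬ ((¬ LineUnramifiedAt W p Φ ∧ LineEven W p Φ) ∨ (LineUnramifiedAt W p Φ ∧ LineOdd W p Φ)) :=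
    fun h ↦ hnot ⟨Φ, hΦ, h⟩
  rcases lineEven_or_lineOdd hΦ with heven | hodd
  · by_cases hunr : LineUnramifiedAt W p Φ
    · exact ⟨Φ', hΦ', Or.inr ⟨hunr_of_unr hunr, hodd_of_even heven⟩⟩
    · exact absurd (Or.inl ⟨hunr, heven⟩) hnot'
  · by_cases hunr : LineUnramifiedAt W p Φ
    · exact absurd (Or.inr ⟨hunr, hodd⟩) hnot'
    · exact ⟨Φ', hΦ', Or.inl ⟨hram_of_ram hunr, heven_of_odd hodd⟩⟩


/-! ### Reducibility is preserved by quadratic twists (appended) -/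

/-- A rational line `Φ ≤ E[p]` witnesses reducibility of `E[p]`: `#Φ = p` is neither `1` nor
`p² = #E[p]`, so `Φ ≠ ⊥, ⊤`. [folklore] -/
theorem not_hasIrreducibleModPGaloisRep_of_isRationalLine {Φ : AddSubgroup (geomTorsion W (p : ℤ))}
    (hΦ : IsRationalLine W p Φ) : ¬ W.HasIrreducibleModPGaloisRep p := by
  have hp : p.Prime := Fact.out
  intro hirr
  have hcard := natCard_geomTorsion W p
  haveI : Finite (geomTorsion W (p : ℤ)) :=
    Nat.finite_of_card_ne_zero (by rw [hcard]; exact pow_ne_zero 2 hp.ne_zero)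
  rcases hirr Φ hΦ.2 with h | h
  · have h1 : Nat.card Φ = 1 := by rw [h]; exact AddSubgroup.card_bot
    rw [hΦ.1] at h1
    exact hp.one_lt.ne' h1
  · have h2 : Nat.card Φ = p ^ 2 := by rw [h, AddSubgroup.card_top, hcard]
    rw [hΦ.1] at h2
    have : p * 1 = p * p := by rw [mul_one, ← pow_two]; exact h2
    exact hp.one_lt.ne (Nat.eq_of_mul_eq_mul_left hp.pos this)

/-- **A quadratic twist of a curve with reducible `E[p]` has reducible `p`-torsion.** Along the
twist isomorphism `F : E^{(d)}(ℚ̄) ≃ E(ℚ̄)` (equivariant up to the sign `σ√d/√d`, Silverman AEC X.5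
Cor. 5.4) the preimage of a rational line of `E[p]` is a rational line of `E^{(d)}[p]` (a sign does
not move a subgroup). [cite: SilvermanAEC2009, X.5 Cor. 5.4] -/
theorem not_hasIrreducibleModPGaloisRep_twist (hred : ¬ W.HasIrreducibleModPGaloisRep p)
    {d : ℚ} (hd : d ≠ 0) (Wd : WeierstrassCurve ℚ) [Wd.IsElliptic] (C : VariableChange ℚ)
    (hC : C • Wd = W.quadraticTwist d) : ¬ Wd.HasIrreducibleModPGaloisRep p := by
  -- the twist isomorphism, equivariant up to sign
  obtain ⟨f, hfpos, hfneg⟩ := W.exists_addEquiv_geomPoints_quadraticTwist_sign hd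
  let e₁ : Wd.geomPoints ≃+ (C • Wd).geomPoints :=
    VariableChange.pointEquivBaseChange Wd C (AlgebraicClosure ℚ)
  let e₂ : (C • Wd).geomPoints ≃+ (W.quadraticTwist d).geomPoints :=
    Affine.Point.congrEquiv (congrArg (fun Z : WeierstrassCurve ℚ ↦ Z.baseChange (AlgebraicClosure ℚ)) hC)
  have h₁ : ∀ (σ : absoluteGaloisGroup ℚ) (P : Wd.geomPoints), e₁ (σ • P) = σ • e₁ P := fun σ P ↦
    VariableChange.pointEquivBaseChange_map_algEquiv Wd C (absoluteGaloisGroup.toAlgEquiv ℚ σ) P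
  have h₂ : ∀ (σ : absoluteGaloisGroup ℚ) (P : (C • Wd).geomPoints), e₂ (σ • P) = σ • e₂ P :=
    fun σ P ↦ congrEquiv_smul_of_eq hC (absoluteGaloisGroup.toAlgEquiv ℚ σ) P
  set F : Wd.geomPoints ≃+ W.geomPoints := (e₁.trans e₂).trans f with hF
  have hFsign : ∀ (σ : absoluteGaloisGroup ℚ) (P : Wd.geomPoints),
      F (σ • P) = σ • F P ∨ F (σ • P) = -(σ • F P) := by
    intro σ P
    rcases smul_geomSqrt_eq_or σ d with hσ | hσ
    · left
      simp only [hF, AddEquiv.trans_apply]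
      rw [h₁, h₂, hfpos σ hσ]
    · right
      simp only [hF, AddEquiv.trans_apply]
      rw [h₁, h₂, hfneg σ hσ]
  -- restriction to `p`-torsion, a bijection
  have hmem : ∀ T : geomTorsion Wd (p : ℤ), F T ∈ geomTorsion W (p : ℤ) := by
    intro T
    rw [AddSubgroup.torsionBy.nsmul_iff, ← map_nsmul, AddSubgroup.torsionBy.nsmul_iff.mp T.2,
      map_zero]
  let φ : geomTorsion Wd (p : ℤ) →+ geomTorsion W (p : ℤ) :=
    AddMonoidHom.codRestrict ((F : Wd.geomPoints →+ W.geomPoints).comp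
      (geomTorsion Wd (p : ℤ)).subtype) (geomTorsion W (p : ℤ)) hmem
  have hφ : ∀ T, ((φ T : geomTorsion W (p : ℤ)) : W.geomPoints) = F T := fun T ↦ rfl
  have hφinj : Function.Injective φ := by
    intro T₁ T₂ h
    have h' := congrArg (fun S : geomTorsion W (p : ℤ) ↦ (S : W.geomPoints)) h
    simp only [hφ] at h'
    exact Subtype.ext (F.injective h')
  have hφsurj : Function.Surjective φ := by
    intro S
    have hS : F.symm S ∈ geomTorsion Wd (p : ℤ) := by
      rw [AddSubgroup.torsionBy.nsmul_iff]
      apply F.injective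
      rw [map_nsmul, AddEquiv.apply_symm_apply, map_zero]
      exact AddSubgroup.torsionBy.nsmul_iff.mp S.2
    refine ⟨⟨F.symm S, hS⟩, Subtype.ext ?_⟩
    rw [hφ]
    exact F.apply_symm_apply S
  let eφ : geomTorsion Wd (p : ℤ) ≃+ geomTorsion W (p : ℤ) := AddEquiv.ofBijective φ ⟨hφinj, hφsurj⟩
  have heφ : ∀ T, eφ T = φ T := fun T ↦ rfl
  have hφsign : ∀ (σ : absoluteGaloisGroup ℚ) (T : geomTorsion Wd (p : ℤ)),
      φ (σ • T) = σ • φ T ∨ φ (σ • T) = -(σ • φ T) := by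
    intro σ T
    rcases hFsign σ T with h | h
    · left
      exact Subtype.ext (by rw [AddSubgroup.torsionBy.coe_smul, hφ, hφ,
        AddSubgroup.torsionBy.coe_smul, h])
    · right
      exact Subtype.ext (by rw [AddSubgroup.coe_neg, AddSubgroup.torsionBy.coe_smul, hφ, hφ,
        AddSubgroup.torsionBy.coe_smul, h])
  -- transport of a rational line
  obtain ⟨Φ, hΦ⟩ := exists_isRationalLine_of_not_irr W p hred
  let Φ' : AddSubgroup (geomTorsion Wd (p : ℤ)) := Φ.map eφ.symm.toAddMonoidHom
  have hmemΦ' : ∀ T, T ∈ Φ' ↔ φ T ∈ Φ := by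
    intro T
    rw [AddSubgroup.mem_map_equiv, AddEquiv.symm_symm, heφ]
  have hcardΦ' : Nat.card Φ' = p :=
    (Nat.card_congr (Φ.equivMapOfInjective eφ.symm.toAddMonoidHom eφ.symm.injective).toEquiv).symm.trans
      hΦ.1
  have hstabΦ' : ∀ (σ : absoluteGaloisGroup ℚ), ∀ T ∈ Φ', σ • T ∈ Φ' := by
    intro σ T hT
    rw [hmemΦ'] at hT ⊢
    rcases hφsign σ T with h | h
    · rw [h]; exact hΦ.2 σ _ hT
    · rw [h]; exact neg_mem (hΦ.2 σ _ hT)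
  exact not_hasIrreducibleModPGaloisRep_of_isRationalLine (W := Wd) ⟨hcardΦ', hstabΦ'⟩

end Literature.NumberTheory.EllipticCurves.Rank1Residual

end
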